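import Mathlib
import HarnessLib
import Literature.Analysis.FluidPDE.Tao2016AveragedNS.LocalCascadeSolutions
import Literature.Analysis.FluidPDE.Tao2016AveragedNS.RenormalisedCascadeWaves
import Literature.Analysis.FluidPDE.Tao2016AveragedNS.SelfSimilarCascadeBlowup
import Literature.Analysis.FluidPDE.Tao2016AveragedNS.ViscousEternalSolutions
import Literature.Analysis.FluidPDE.Tao2016AveragedNS.BoundedEternalSolutions
import Summits.NavierStokesRegularity.NavierStokesRegularity.Theses.TaoLadderRungTwoBreak
import Summits.NavierStokesRegularity.NavierStokesRegularity.Theorems.TaoLadderRungTwoBreakEternalRigidityViscBddOneDefs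
import Summits.NavierStokesRegularity.NavierStokesRegularity.Theorems.TaoLadderRungTwoBreakEternalRigidityViscBddOneStubViscousBlowup

/-!
# Crux `TaoLadderRungTwoBreak.EternalRigidityViscBddOne` (stmt-NavierStokesRegularity-20420): the registered
# skeleton's COMPOSITION in the tree, closed modulo exactly the two open stubs (ω3) `stub_typeOne` and
# (ω4) `stub_eternalLimitViscBdd`; and the consequence-crux link `Target ⇒ EternalRigidityViscBddOne`

The registered skeleton `EternalRigidityViscBddOne_birth.lean` (sha16 `85fbfe8e90eea58b`) composes three stubs
into the crux: (ω1) `stub_viscousBlowup` — LANDED (`…EternalRigidityViscBddOneStubViscousBlowup`), (ω3)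
`stub_typeOne` (type-I rate of sub-threshold viscous blow-up in the comparable class — the cell's N-39 risk) and
(ω4) `stub_eternalLimitViscBdd` (ω-limit extraction recording the inherited bound and forward survival).  Here:

* `eternalRigidityViscBddOne_of_stubs` — the skeleton's composition VERBATIM (κ-normal form of robust blow-up
  `noGlobalCascade_iff_kappa`, viscosity `ν = κ/√2`), with (ω1) supplied by the landed theorem and (ω3), (ω4)
  quoted VERBATIM as hypotheses: after this file the crux ⟨20420⟩ is, in the tree, EXACTLY (ω3) ∧ (ω4) along
  this line;
* `eternalRigidityViscBddOne_of_target` — the route's `Target` (no robust blow-up below `ε_R`) gives the crux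
  VACUOUSLY (previously only the cell package's `GlueSelfcheck.lean`): K2ᵛ(1) is a consequence-crux whose
  content lives on tables where the Target fails.

For the record (not used here): the alternative decomposition of the SAME shared decl through route WakeRatchet,
`MinimalViscousBlowup ⟨22743⟩ → MinimalBlowupExtraction ⟨22744, PROVED⟩ → EternalRigidityViscBddOne`
(`wakeRatchet_eternalRigidityViscBddOneOfMinimalBlowup_proof`), trades (ω3)+(ω4) for ONE blow-up crux carrying
the type-I clock, the per-shell action/energy ceilings and the firing floor BY SELECTION of the threshold
viscosity; (ω4) as typed here asks the extraction WITHOUT those ceilings/floor.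

HONEST LABEL: bookkeeping (composition + one vacuous implication); MODEL lattice ODEs of Tao 2016 §4 only;
⟨20420⟩, (ω3), (ω4), the Target and every NS statement remain OPEN; nothing here bears on the summit.
-/

noncomputable section

-- the summit and its single sub-problem share the name (CONVENTIONS §1)
set_option linter.dupNamespace false

namespace Summit.NavierStokesRegularity.NavierStokesRegularity.Theorems.EternalRigidityViscBddOne.Birth

open Set
open Literature.Analysis.FluidPDE Literature.Analysis.FluidPDE.TaoCascade
open Summit.NavierStokesRegularity.NavierStokesRegularity.Theses.TaoLadderRungTwoBreak

/-- **The skeleton's composition, closed modulo (ω3) and (ω4).**  With (ω1) `stub_viscousBlowup` LANDED, the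
registered stubs (ω3) `stub_typeOne` and (ω4) `stub_eternalLimitViscBdd` (signatures VERBATIM as hypotheses)
give the route crux `EternalRigidityViscBddOne` BY NAME (thresholds by `min`; κ-normal form of robust blow-up
`noGlobalCascade_iff_kappa`, viscosity `ν = κ/√2`).
[cite: Tao2016AveragedNS, §4 Thm. 4.2 with Lemma 4.1 (4.5)–(4.11) and the viscous equation before Thm. 4.2, §6.4; cell composition (theory-2 `eternalRigidityViscBddOne_of`)] -/
theorem eternalRigidityViscBddOne_of_stubs
    (h3 : ∀ R : ℝ, 1 ≤ R → ∃ εs : ℝ, 0 < εs ∧ ∀ ε₀ : ℝ, 0 < ε₀ → ε₀ ≤ εs →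
      ∀ (α : Fin 4 → Fin 4 → Fin 4 → ℤ × ℤ × ℤ → ℝ) (X₀ : Fin 4 → ℝ), InTableClass R α →
        ∀ ν : ℝ, 0 < ν → ∀ (X : Fin 4 → ℤ → ℝ → ℝ) (tStar : ℝ),
          ViscousUpTo ε₀ ν α X₀ X tStar → BlowsUpAt ε₀ X tStar → TypeOne ε₀ X tStar)
    (h4 : ∀ R : ℝ, 1 ≤ R → ∃ εs : ℝ, 0 < εs ∧ ∀ ε₀ : ℝ, 0 < ε₀ → ε₀ ≤ εs →
      ∀ (α : Fin 4 → Fin 4 → Fin 4 → ℤ × ℤ × ℤ → ℝ) (X₀ : Fin 4 → ℝ), InTableClass R α →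
        ∀ ν : ℝ, 0 < ν → ∀ (X : Fin 4 → ℤ → ℝ → ℝ) (tStar : ℝ),
          ViscousUpTo ε₀ ν α X₀ X tStar → BlowsUpAt ε₀ X tStar → TypeOne ε₀ X tStar →
            ∃ (νh : ℝ) (W : ℤ → ℝ → Em 4), IsEternalVisc ε₀ νh α W ∧ UniformBound W ∧
              EternalSurvivingFwd 1 ε₀ W) :
    EternalRigidityViscBddOne := by
  intro R hR
  obtain ⟨ε₂, hε₂, H2⟩ := h3 R hR
  obtain ⟨ε₄, hε₄, H4⟩ := h4 R hR
  refine ⟨min ε₂ ε₄, lt_min hε₂ hε₄, ?_⟩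
  intro ε₀ hε₀ hle α X₀ hα hNG
  have hle₂ : ε₀ ≤ ε₂ := hle.trans (min_le_left _ _)
  have hle₄ : ε₀ ≤ ε₄ := hle.trans (min_le_right _ _)
  obtain ⟨κ, hκ, hnot⟩ := (noGlobalCascade_iff_kappa hε₀).1 hNG
  have h2pos : 0 < Real.sqrt 2 := Real.sqrt_pos.2 two_pos
  have hν : 0 < κ / Real.sqrt 2 := div_pos hκ h2pos
  have hνκ : κ / Real.sqrt 2 * Real.sqrt 2 ≤ κ := by
    rw [div_mul_cancel₀ κ (ne_of_gt h2pos)]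
  obtain ⟨X, tStar, hV, hB⟩ := stub_viscousBlowup R hR ε₀ hε₀ α X₀ hα κ (κ / Real.sqrt 2) hν hνκ hnot
  exact H4 ε₀ hε₀ hle₄ α X₀ hα _ hν X tStar hV hB (H2 ε₀ hε₀ hle₂ α X₀ hα _ hν X tStar hV hB)

/-- **`Target ⇒ EternalRigidityViscBddOne` (vacuously).**  Below the Target's threshold `ε_R` no table of
`InTableClass R` blows up robustly from a one-shell datum, so the extraction demanded by K2ᵛ(1) is never
triggered: the consequence-crux ⟨20420⟩ follows from the rung leaf it serves (its content lives on tables where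
the Target fails).  Previously only in the cell package (`eternalRigidityViscBddOne_of_target`, GlueSelfcheck).
[cite: Tao2016AveragedNS, §4 Thm. 4.2 (statement shape); cell link] -/
theorem eternalRigidityViscBddOne_of_target (hT : Target) : EternalRigidityViscBddOne := by
  intro R hR
  obtain ⟨εR, hεR, H⟩ := hT R hR
  exact ⟨εR, hεR, fun ε₀ hε₀ hle α X₀ hα hNG => absurd hNG (H ε₀ hε₀ hle α X₀ hα)⟩

end Summit.NavierStokesRegularity.NavierStokesRegularity.Theorems.EternalRigidityViscBddOne.Birth

end
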